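import Summits.Ventures.PercRepro.S2LPCoresP11D6to10
import Summits.Ventures.PercRepro.S2LPCoresP11D11to15
import Summits.Ventures.PercRepro.S2LPCoresP11D16to20
import Summits.Ventures.PercRepro.S2LPCoresP11D21to25
import Summits.Ventures.PercRepro.S2LPCoresP11D26to30
import Summits.Ventures.PercRepro.S2LPCoresP11D31to35
import Summits.Ventures.PercRepro.S2LPCoresP11D36to40
import Summits.Ventures.PercRepro.S2LPCoresP11D41to45
import Summits.Ventures.PercRepro.S2LPCoresP11D46to50
import Summits.Ventures.PercRepro.S2LPCoresP11D51to55
import Summits.Ventures.PercRepro.S2ElevenKeyCellsA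
import Summits.Ventures.PercRepro.S2ElevenKeyCellsB
import Summits.Ventures.PercRepro.HyperplaneKeyFive
import Summits.Ventures.PercRepro.RankLevelSetLevelFiveCqThirteen
import Summits.Ventures.PercRepro.S2RowStep

/-!
# PercRepro — THEOREM C₅ AT EVERY `p ≥ 12` (p7, gen 20; sub-claim S2): THE `p = 11` ROW, THE RUNG `12` OF THE LEVEL-5 LADDER

The `p = 11` row of the `e`-free core at every corank `d ≥ 6`: `6 ≤ d ≤ 55` by the LP-certificate cells in SUBCLAIM-S2's form (`S2LP.c025_core_five_eleven_<d>`, p2's exact certificates / the consumer pipeline), `56 ≤ d ≤ 74` by the plain key cells (`c025_eleven_key_<d>`), `d ≥ 75` by p1's hyperplane key `HypKey.c025_core_five_hyperplane_key_eleven` (`n ≥ 86`):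
**`c025_core_five_eleven_all (M) [M.Finite] (hR : ρ(E) = 11) (hbig : 11 + 5 < |E|) (hfree) : RLS M 11 5`**. With the row step
(`c025_five_large_of_rows 12`, the rows `11` and `12`, Theorem C₅ at `13`): **`c025_five_large_sharp12 (M) [M.Finite] (p) (hp : 12 ≤ p) :
RLS M p 5`**. No window move is claimed here (the lead's). Axioms: standard.
-/

open scoped Matroid

namespace PercRepro

namespace ThmN

variable {α : Type}

/-- The LP-certificate cells of the `p = 11` row, `6 ≤ d ≤ 21` (p2's form `S2LP.c025_core_five_eleven_<d>`), dispatched by `d`. -/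
theorem c025_core_five_eleven_lpa (M : Matroid α) [M.Finite] (d : ℕ) (hda : 6 ≤ d) (hdb : d ≤ 21)
    (hR : M.eRank = ((11 : ℕ) : ℕ∞)) (hn : M.E.ncard = 11 + d)
    (hfree : ∀ e ∈ M.E, ∃ A ⊆ M.E \ {e}, e ∉ M.closure A ∧ e ∉ M.closure ((M.E \ {e}) \ A)) : RLS M 11 5 := by
  interval_cases d
  · exact S2LP.c025_core_five_eleven_six M hR hn hfree
  · exact S2LP.c025_core_five_eleven_seven M hR hn hfree
  · exact S2LP.c025_core_five_eleven_eight M hR hn hfree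
  · exact S2LP.c025_core_five_eleven_nine M hR hn hfree
  · exact S2LP.c025_core_five_eleven_ten M hR hn hfree
  · exact S2LP.c025_core_five_eleven_eleven M hR hn hfree
  · exact S2LP.c025_core_five_eleven_twelve M hR hn hfree
  · exact S2LP.c025_core_five_eleven_thirteen M hR hn hfree
  · exact S2LP.c025_core_five_eleven_fourteen M hR hn hfree
  · exact S2LP.c025_core_five_eleven_fifteen M hR hn hfree
  · exact S2LP.c025_core_five_eleven_sixteen M hR hn hfree
  · exact S2LP.c025_core_five_eleven_seventeen M hR hn hfree
  · exact S2LP.c025_core_five_eleven_eighteen M hR hn hfree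
  · exact S2LP.c025_core_five_eleven_nineteen M hR hn hfree
  · exact S2LP.c025_core_five_eleven_twenty M hR hn hfree
  · exact S2LP.c025_core_five_eleven_twentyone M hR hn hfree

/-- The LP-certificate cells of the `p = 11` row, `22 ≤ d ≤ 37` (p2's form `S2LP.c025_core_five_eleven_<d>`), dispatched by `d`. -/
theorem c025_core_five_eleven_lpb (M : Matroid α) [M.Finite] (d : ℕ) (hda : 22 ≤ d) (hdb : d ≤ 37)
    (hR : M.eRank = ((11 : ℕ) : ℕ∞)) (hn : M.E.ncard = 11 + d)
    (hfree : ∀ e ∈ M.E, ∃ A ⊆ M.E \ {e}, e ∉ M.closure A ∧ e ∉ M.closure ((M.E \ {e}) \ A)) : RLS M 11 5 := by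
  interval_cases d
  · exact S2LP.c025_core_five_eleven_twentytwo M hR hn hfree
  · exact S2LP.c025_core_five_eleven_twentythree M hR hn hfree
  · exact S2LP.c025_core_five_eleven_twentyfour M hR hn hfree
  · exact S2LP.c025_core_five_eleven_twentyfive M hR hn hfree
  · exact S2LP.c025_core_five_eleven_twentysix M hR hn hfree
  · exact S2LP.c025_core_five_eleven_twentyseven M hR hn hfree
  · exact S2LP.c025_core_five_eleven_twentyeight M hR hn hfree
  · exact S2LP.c025_core_five_eleven_twentynine M hR hn hfree
  · exact S2LP.c025_core_five_eleven_thirty M hR hn hfree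
  · exact S2LP.c025_core_five_eleven_thirtyone M hR hn hfree
  · exact S2LP.c025_core_five_eleven_thirtytwo M hR hn hfree
  · exact S2LP.c025_core_five_eleven_thirtythree M hR hn hfree
  · exact S2LP.c025_core_five_eleven_thirtyfour M hR hn hfree
  · exact S2LP.c025_core_five_eleven_thirtyfive M hR hn hfree
  · exact S2LP.c025_core_five_eleven_thirtysix M hR hn hfree
  · exact S2LP.c025_core_five_eleven_thirtyseven M hR hn hfree

/-- The LP-certificate cells of the `p = 11` row, `38 ≤ d ≤ 53` (p2's form `S2LP.c025_core_five_eleven_<d>`), dispatched by `d`. -/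
theorem c025_core_five_eleven_lpc (M : Matroid α) [M.Finite] (d : ℕ) (hda : 38 ≤ d) (hdb : d ≤ 53)
    (hR : M.eRank = ((11 : ℕ) : ℕ∞)) (hn : M.E.ncard = 11 + d)
    (hfree : ∀ e ∈ M.E, ∃ A ⊆ M.E \ {e}, e ∉ M.closure A ∧ e ∉ M.closure ((M.E \ {e}) \ A)) : RLS M 11 5 := by
  interval_cases d
  · exact S2LP.c025_core_five_eleven_thirtyeight M hR hn hfree
  · exact S2LP.c025_core_five_eleven_thirtynine M hR hn hfree
  · exact S2LP.c025_core_five_eleven_forty M hR hn hfree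
  · exact S2LP.c025_core_five_eleven_fortyone M hR hn hfree
  · exact S2LP.c025_core_five_eleven_fortytwo M hR hn hfree
  · exact S2LP.c025_core_five_eleven_fortythree M hR hn hfree
  · exact S2LP.c025_core_five_eleven_fortyfour M hR hn hfree
  · exact S2LP.c025_core_five_eleven_fortyfive M hR hn hfree
  · exact S2LP.c025_core_five_eleven_fortysix M hR hn hfree
  · exact S2LP.c025_core_five_eleven_fortyseven M hR hn hfree
  · exact S2LP.c025_core_five_eleven_fortyeight M hR hn hfree
  · exact S2LP.c025_core_five_eleven_fortynine M hR hn hfree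
  · exact S2LP.c025_core_five_eleven_fifty M hR hn hfree
  · exact S2LP.c025_core_five_eleven_fiftyone M hR hn hfree
  · exact S2LP.c025_core_five_eleven_fiftytwo M hR hn hfree
  · exact S2LP.c025_core_five_eleven_fiftythree M hR hn hfree

/-- The LP-certificate cells of the `p = 11` row, `54 ≤ d ≤ 55` (p2's form `S2LP.c025_core_five_eleven_<d>`), dispatched by `d`. -/
theorem c025_core_five_eleven_lpd (M : Matroid α) [M.Finite] (d : ℕ) (hda : 54 ≤ d) (hdb : d ≤ 55)
    (hR : M.eRank = ((11 : ℕ) : ℕ∞)) (hn : M.E.ncard = 11 + d)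
    (hfree : ∀ e ∈ M.E, ∃ A ⊆ M.E \ {e}, e ∉ M.closure A ∧ e ∉ M.closure ((M.E \ {e}) \ A)) : RLS M 11 5 := by
  interval_cases d
  · exact S2LP.c025_core_five_eleven_fiftyfour M hR hn hfree
  · exact S2LP.c025_core_five_eleven_fiftyfive M hR hn hfree

/-- The plain key cells of the `p = 11` row, `56 ≤ d ≤ 71` (`c025_eleven_key_<d>`), dispatched by `d`. -/
theorem c025_core_five_eleven_keya (M : Matroid α) [M.Finite] (d : ℕ) (hda : 56 ≤ d) (hdb : d ≤ 71)
    (hR : M.eRank = ((11 : ℕ) : ℕ∞)) (hn : M.E.ncard = 11 + d)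
    (hfree : ∀ e ∈ M.E, ∃ A ⊆ M.E \ {e}, e ∉ M.closure A ∧ e ∉ M.closure ((M.E \ {e}) \ A)) : RLS M 11 5 := by
  interval_cases d
  · exact c025_eleven_key_56 M hR hn hfree
  · exact c025_eleven_key_57 M hR hn hfree
  · exact c025_eleven_key_58 M hR hn hfree
  · exact c025_eleven_key_59 M hR hn hfree
  · exact c025_eleven_key_60 M hR hn hfree
  · exact c025_eleven_key_61 M hR hn hfree
  · exact c025_eleven_key_62 M hR hn hfree
  · exact c025_eleven_key_63 M hR hn hfree
  · exact c025_eleven_key_64 M hR hn hfree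
  · exact c025_eleven_key_65 M hR hn hfree
  · exact c025_eleven_key_66 M hR hn hfree
  · exact c025_eleven_key_67 M hR hn hfree
  · exact c025_eleven_key_68 M hR hn hfree
  · exact c025_eleven_key_69 M hR hn hfree
  · exact c025_eleven_key_70 M hR hn hfree
  · exact c025_eleven_key_71 M hR hn hfree

/-- The plain key cells of the `p = 11` row, `72 ≤ d ≤ 74` (`c025_eleven_key_<d>`), dispatched by `d`. -/
theorem c025_core_five_eleven_keyb (M : Matroid α) [M.Finite] (d : ℕ) (hda : 72 ≤ d) (hdb : d ≤ 74)
    (hR : M.eRank = ((11 : ℕ) : ℕ∞)) (hn : M.E.ncard = 11 + d)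
    (hfree : ∀ e ∈ M.E, ∃ A ⊆ M.E \ {e}, e ∉ M.closure A ∧ e ∉ M.closure ((M.E \ {e}) \ A)) : RLS M 11 5 := by
  interval_cases d
  · exact c025_eleven_key_72 M hR hn hfree
  · exact c025_eleven_key_73 M hR hn hfree
  · exact c025_eleven_key_74 M hR hn hfree

/-- **THE WHOLE `p = 11` ROW FOR CORES**: every `e`-free core of rank `11` on `> 16` points satisfies `RLS M 11 5`. -/
theorem c025_core_five_eleven_all (M : Matroid α) [M.Finite]
    (hR : M.eRank = ((11 : ℕ) : ℕ∞)) (hbig : 11 + 5 < M.E.ncard)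
    (hfree : ∀ e ∈ M.E, ∃ A ⊆ M.E \ {e}, e ∉ M.closure A ∧ e ∉ M.closure ((M.E \ {e}) \ A)) : RLS M 11 5 := by
  have hn : M.E.ncard = 11 + (M.E.ncard - 11) := by omega
  rcases Nat.lt_or_ge M.E.ncard (11 + 22) with h21 | h21
  · exact c025_core_five_eleven_lpa M (M.E.ncard - 11) (by omega) (by omega) hR hn hfree
  rcases Nat.lt_or_ge M.E.ncard (11 + 38) with h37 | h37
  · exact c025_core_five_eleven_lpb M (M.E.ncard - 11) (by omega) (by omega) hR hn hfree
  rcases Nat.lt_or_ge M.E.ncard (11 + 54) with h53 | h53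
  · exact c025_core_five_eleven_lpc M (M.E.ncard - 11) (by omega) (by omega) hR hn hfree
  rcases Nat.lt_or_ge M.E.ncard (11 + 56) with h55 | h55
  · exact c025_core_five_eleven_lpd M (M.E.ncard - 11) (by omega) (by omega) hR hn hfree
  rcases Nat.lt_or_ge M.E.ncard (11 + 72) with h71 | h71
  · exact c025_core_five_eleven_keya M (M.E.ncard - 11) (by omega) (by omega) hR hn hfree
  rcases Nat.lt_or_ge M.E.ncard (11 + 75) with h74 | h74
  · exact c025_core_five_eleven_keyb M (M.E.ncard - 11) (by omega) (by omega) hR hn hfree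
  exact HypKey.c025_core_five_hyperplane_key_eleven M hR (by omega) hfree

/-- **THEOREM C₅ AT EVERY `p ≥ 12`**: `RLS M p 5` for every finite matroid and every `p ≥ 12` (the row step on the rows `11` and `12`). -/
theorem c025_five_large_sharp12 (M : Matroid α) [M.Finite] (p : ℕ) (hp : 12 ≤ p) : RLS M p 5 :=
  c025_five_large_of_rows 12 (by norm_num)
    (fun M _ hR hbig hfree => c025_core_five_eleven_all M hR hbig hfree)
    (fun M _ hR hbig hfree => c025_core_five_twelve_all M hR hbig hfree)
    (fun M _ p hp => c025_five_large_sharp13 M p hp) M p hp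

end ThmN

end PercRepro
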